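import Summits.SmoothPoincare4.SmoothPoincare4.Theorems.ShadowsStandard.Negative.HomSets
import Summits.SmoothPoincare4.SmoothPoincare4.Theorems.CongruenceShadowsShadowsStandardStubFaceNormalFormGenusThree
import Summits.SmoothPoincare4.SmoothPoincare4.Theorems.CongruenceShadowsShadowsStandardEffectiveCentreless
import HarnessLib

/-!
# The residue reduction of the crux `ShadowsStandard` (line `finitary-ac-central-residue`,
item stmt-SmoothPoincare4-14593)

`S = S_{3+3m}`, `N = s4Kernels.stabilizeIter m` (standard balanced trisection of `S⁴`),
`K = (N 0, N 1, K 2)` a slot-normalised `(3+3m; m+1)` group trisection of the trivial group,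
`M ≤ S` characteristic of finite index.  Two statements about EXACT elements of the Goeritz group
`St₀ ∩ St₁ = Stab(N 0) ∩ Stab(N 1)` of the standard genus-`3k` Heegaard splitting of `#ᵏ S¹×S²`:

* ONE-SIDED NORMAL FORM at genus `3+3m` (`OneSided m` below, written inline): for all such `K, M`
  some `χ ∈ St₀ ∩ St₁` has `χ(N 2 ⊔ N 0 ⊔ M) = K 2 ⊔ N 0 ⊔ M`;
* INTERSECTION RIGIDITY at genus `3+3m` (`Rigid m`, the line's load-bearing stub, verbatim): for all
  such `K, M` in normal form (`K 2 ⊔ N 0 ⊔ M = N 2 ⊔ N 0 ⊔ M`) some `φ ∈ St₀ ∩ St₁` fixes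
  `N 2 ⊔ N 0 ⊔ M` and carries `(N 0 ⊔ M) ⊓ (N 2 ⊔ M)` to `(N 0 ⊔ M) ⊓ (K 2 ⊔ M)`.

**Theorem** (`stub_exactShadowReduction`, a registered stub of the line): effective centrelessness
∧ one-sided normal form ∧ intersection rigidity (at every level) ⟹ for all such `K, M` some EXACT `ψ ∈ St₀ ∩ St₁` has `ψ(N i ⊔ M) = K i ⊔ M` for
all `i` — the normalised crux with exact Goeritz stabilisers.  The proof is the two-level residue
lemma fed by effective centrelessness (hypotheses here; discharged at every genus by
`stub_effectiveCentrelessStd/Trisection` of `…EffectiveCentreless.lean`, proved there from the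
four landed stubs): no profinite object appears.
Conversely (`rigid_of_exactShadow`) the exact-Goeritz crux implies intersection rigidity
trivially, so at every genus where the one-sided normal form is known — genus `3`, by the tree's
face normal form `stub_faceNormalFormGenusThree` — INTERSECTION RIGIDITY IS EQUIVALENT TO THE
NORMALISED CRUX WITH EXACT GOERITZ STABILISERS (`rigid_genusThree_iff_exactShadow`), and implies
the genus-3 case of `ShadowsStandard` given the `(0,1)` slice of `WaldhausenPairs`
(`shadowStandardAt_genusThree_of_rigid`).  This is the honest size of the line's residual: it is
the genus-`g` crux in residue coordinates, sandwiched between `Iso N K` and the crux. [folklore]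
-/

-- the prescribed namespace `Summit.<P>.<Sub>.…` duplicates `SmoothPoincare4` (P = Sub)
set_option linter.dupNamespace false

noncomputable section

namespace Summit.SmoothPoincare4.SmoothPoincare4.Theorems.ShadowsStandard.FinitaryAcCentralResidue

open Literature.Topology.FourManifolds Subgroup
open _root_.Summit.SmoothPoincare4.SmoothPoincare4.Theorems.ShadowsStandard.Negative
  (isGroupTrisection_map_equiv ShadowStandardAt)
open _root_.Summit.SmoothPoincare4.SmoothPoincare4.Theorems.ShadowsStandard.PowerTwistAbsorption
  (stub_faceNormalFormGenusThree)

variable {m : ℕ}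

/-! ## Small transport facts -/

/-- `e⁻¹` undoes `e` on subgroups. [folklore] -/
private theorem rr_map_map_symm {G : Type*} [Group G] (e : G ≃* G) (H : Subgroup G) :
    (H.map e.toMonoidHom).map e.symm.toMonoidHom = H := by
  ext x; simp

/-- `e` undoes `e⁻¹` on subgroups. [folklore] -/
private theorem rr_map_symm_map {G : Type*} [Group G] (e : G ≃* G) (H : Subgroup G) :
    (H.map e.symm.toMonoidHom).map e.toMonoidHom = H := by
  ext x; simp

/-- If `e(H) = L` then `e⁻¹(L) = H`. [folklore] -/
private theorem rr_map_symm_of_map {G : Type*} [Group G] (e : G ≃* G) {H L : Subgroup G}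
    (h : H.map e.toMonoidHom = L) : L.map e.symm.toMonoidHom = H := by
  rw [← h, rr_map_map_symm]

/-- A characteristic subgroup is fixed by every automorphism (as `map`). [folklore] -/
private theorem rr_map_char {G : Type*} [Group G] (e : G ≃* G) {M : Subgroup G}
    (hM : M.Characteristic) : M.map e.toMonoidHom = M :=
  (Subgroup.characteristic_iff_map_eq.mp hM) e

/-- The intersection of two characteristic subgroups is characteristic. [folklore] -/
private theorem rr_characteristic_inf {G : Type*} [Group G] {H L : Subgroup G}
    (hH : H.Characteristic) (hL : L.Characteristic) : (H ⊓ L).Characteristic := by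
  rw [Subgroup.characteristic_iff_comap_eq] at *
  intro ϕ
  rw [Subgroup.comap_inf, hH ϕ, hL ϕ]

/-- Three cases make a statement about `Fin 3`. [folklore] -/
private theorem rr_forall_fin_three {P : Fin 3 → Prop} (h0 : P 0) (h1 : P 1) (h2 : P 2) :
    ∀ i, P i := by
  intro i
  match i with
  | ⟨0, _⟩ => exact h0
  | ⟨1, _⟩ => exact h1
  | ⟨2, _⟩ => exact h2

/-! ## The reduction -/

/-- **One level step.** For a slot-normalised triple `K`, levels `M' ≤ M` (characteristic, `M'`
of finite index) with effective centrelessness between them for `(N 0, N 2)` and `(N 0, K 2)`,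
an exact Goeritz element `χ` putting `K` in one-sided normal form at level `M'` and intersection
rigidity for `χ⁻¹ • K` at level `M'` give an EXACT Goeritz element `ψ` with
`ψ(N i ⊔ M) = K i ⊔ M` for all `i`. [folklore] -/
theorem exactShadow_step (K : TrisectionKernels (3 + 3 * m))
    (hK : IsGroupTrisection (3 + 3 * m) (m + 1) (PUnit : Type) K)
    (h0 : K 0 = s4Kernels.stabilizeIter m 0) (h1 : K 1 = s4Kernels.stabilizeIter m 1)
    (M M' : Subgroup (SurfaceGroup (3 + 3 * m)))
    (hM : M.Characteristic) (hM' : M'.Characteristic) (hle : M' ≤ M)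
    (hZN : ∀ x ∈ s4Kernels.stabilizeIter m 0, (∀ y ∈ s4Kernels.stabilizeIter m 0,
        y * x * y⁻¹ * x⁻¹ ∈ s4Kernels.stabilizeIter m 2 ⊔ M') → x ∈ s4Kernels.stabilizeIter m 2 ⊔ M)
    (hZK : haveI : (K 2).Normal := hK.normal 2
      ∀ x ∈ s4Kernels.stabilizeIter m 0, (∀ y ∈ s4Kernels.stabilizeIter m 0,
        y * x * y⁻¹ * x⁻¹ ∈ K 2 ⊔ M') → x ∈ K 2 ⊔ M)
    (χ : SurfaceGroup (3 + 3 * m) ≃* SurfaceGroup (3 + 3 * m))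
    (hχ0 : (s4Kernels.stabilizeIter m 0).map χ.toMonoidHom = s4Kernels.stabilizeIter m 0)
    (hχ1 : (s4Kernels.stabilizeIter m 1).map χ.toMonoidHom = s4Kernels.stabilizeIter m 1)
    (hχ2 : (s4Kernels.stabilizeIter m 2 ⊔ s4Kernels.stabilizeIter m 0 ⊔ M').map χ.toMonoidHom =
      K 2 ⊔ s4Kernels.stabilizeIter m 0 ⊔ M')
    (rigid : ∀ K' : TrisectionKernels (3 + 3 * m),
      IsGroupTrisection (3 + 3 * m) (m + 1) (PUnit : Type) K' →
      K' 0 = s4Kernels.stabilizeIter m 0 → K' 1 = s4Kernels.stabilizeIter m 1 →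
      K' 2 ⊔ s4Kernels.stabilizeIter m 0 ⊔ M' =
        s4Kernels.stabilizeIter m 2 ⊔ s4Kernels.stabilizeIter m 0 ⊔ M' →
      ∃ φ : SurfaceGroup (3 + 3 * m) ≃* SurfaceGroup (3 + 3 * m),
        (s4Kernels.stabilizeIter m 0).map φ.toMonoidHom = s4Kernels.stabilizeIter m 0 ∧
        (s4Kernels.stabilizeIter m 1).map φ.toMonoidHom = s4Kernels.stabilizeIter m 1 ∧
        (s4Kernels.stabilizeIter m 2 ⊔ s4Kernels.stabilizeIter m 0 ⊔ M').map φ.toMonoidHom =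
          s4Kernels.stabilizeIter m 2 ⊔ s4Kernels.stabilizeIter m 0 ⊔ M' ∧
        ((s4Kernels.stabilizeIter m 0 ⊔ M') ⊓ (s4Kernels.stabilizeIter m 2 ⊔ M')).map φ.toMonoidHom =
          (s4Kernels.stabilizeIter m 0 ⊔ M') ⊓ (K' 2 ⊔ M')) :
    ∃ ψ : SurfaceGroup (3 + 3 * m) ≃* SurfaceGroup (3 + 3 * m),
      (s4Kernels.stabilizeIter m 0).map ψ.toMonoidHom = s4Kernels.stabilizeIter m 0 ∧
      (s4Kernels.stabilizeIter m 1).map ψ.toMonoidHom = s4Kernels.stabilizeIter m 1 ∧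
      ∀ i : Fin 3, (s4Kernels.stabilizeIter m i ⊔ M).map ψ.toMonoidHom = K i ⊔ M := by
  haveI hMn : M.Normal := by haveI := hM; infer_instance
  haveI hM'n : M'.Normal := by haveI := hM'; infer_instance
  haveI hK2n : (K 2).Normal := hK.normal 2
  -- `K' := χ⁻¹ • K` is slot-normalised, a trisection of `{1}`, and in normal form at level `M'`
  have hK' : IsGroupTrisection (3 + 3 * m) (m + 1) (PUnit : Type)
      (fun i => (K i).map χ.symm.toMonoidHom) := isGroupTrisection_map_equiv hK χ.symm
  have h0' : (K 0).map χ.symm.toMonoidHom = s4Kernels.stabilizeIter m 0 := by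
    rw [h0]; exact rr_map_symm_of_map χ hχ0
  have h1' : (K 1).map χ.symm.toMonoidHom = s4Kernels.stabilizeIter m 1 := by
    rw [h1]; exact rr_map_symm_of_map χ hχ1
  have hsup' : (K 2).map χ.symm.toMonoidHom ⊔ s4Kernels.stabilizeIter m 0 ⊔ M' =
      s4Kernels.stabilizeIter m 2 ⊔ s4Kernels.stabilizeIter m 0 ⊔ M' := by
    have := congrArg (Subgroup.map χ.symm.toMonoidHom) hχ2
    rw [rr_map_map_symm, Subgroup.map_sup, Subgroup.map_sup, rr_map_char χ.symm hM',
      rr_map_symm_of_map χ hχ0] at this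
    exact this.symm
  haveI hK'2n : ((K 2).map χ.symm.toMonoidHom).Normal := hK'.normal 2
  -- intersection rigidity for `K'` at level `M'`
  obtain ⟨φ, hφ0, hφ1, hφ2, hφ3⟩ :=
    rigid (fun i => (K i).map χ.symm.toMonoidHom) hK' h0' h1' hsup'
  haveI hAn : ((s4Kernels.stabilizeIter m 2).map φ.toMonoidHom).Normal :=
    Subgroup.Normal.map inferInstance _ φ.surjective
  -- the two-level residue lemma: `φ(N 2) ⊔ M = K' 2 ⊔ M`
  have hφM' : M'.map φ.toMonoidHom = M' := rr_map_char φ hM'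
  have hφM : M.map φ.toMonoidHom = M := rr_map_char φ hM
  have hφ2' : (s4Kernels.stabilizeIter m 2).map φ.toMonoidHom ⊔ s4Kernels.stabilizeIter m 0 ⊔ M' =
      s4Kernels.stabilizeIter m 2 ⊔ s4Kernels.stabilizeIter m 0 ⊔ M' := by
    rw [← hφ2, Subgroup.map_sup, Subgroup.map_sup, hφ0, hφM']
  have key : (s4Kernels.stabilizeIter m 2).map φ.toMonoidHom ⊔ M =
      (K 2).map χ.symm.toMonoidHom ⊔ M := by
    refine residue_two_level_eq (s4Kernels.stabilizeIter m 0)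
      ((s4Kernels.stabilizeIter m 2).map φ.toMonoidHom) ((K 2).map χ.symm.toMonoidHom) M' M hle
      ?_ ?_ ?_ ?_ ?_ ?_
    · rw [hφ2', ← hsup']
      exact le_sup_left.trans le_sup_left
    · rw [hsup', ← hφ2']
      exact le_sup_left.trans le_sup_left
    · calc s4Kernels.stabilizeIter m 0 ⊓ (K 2).map χ.symm.toMonoidHom
          ≤ (s4Kernels.stabilizeIter m 0 ⊔ M') ⊓ ((K 2).map χ.symm.toMonoidHom ⊔ M') :=
            inf_le_inf le_sup_left le_sup_left
        _ = ((s4Kernels.stabilizeIter m 0 ⊔ M') ⊓ (s4Kernels.stabilizeIter m 2 ⊔ M')).map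
              φ.toMonoidHom := hφ3.symm
        _ ≤ (s4Kernels.stabilizeIter m 2 ⊔ M').map φ.toMonoidHom := Subgroup.map_mono inf_le_right
        _ = (s4Kernels.stabilizeIter m 2).map φ.toMonoidHom ⊔ M' := by
            rw [Subgroup.map_sup, hφM']
    · calc s4Kernels.stabilizeIter m 0 ⊓ (s4Kernels.stabilizeIter m 2).map φ.toMonoidHom
          ≤ (s4Kernels.stabilizeIter m 0 ⊔ M') ⊓
              ((s4Kernels.stabilizeIter m 2).map φ.toMonoidHom ⊔ M') :=
            inf_le_inf le_sup_left le_sup_left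
        _ = ((s4Kernels.stabilizeIter m 0 ⊔ M') ⊓ (s4Kernels.stabilizeIter m 2 ⊔ M')).map
              φ.toMonoidHom := by
            rw [Subgroup.map_inf_eq _ _ _ φ.injective, Subgroup.map_sup, Subgroup.map_sup, hφ0,
              hφM']
        _ = (s4Kernels.stabilizeIter m 0 ⊔ M') ⊓ ((K 2).map χ.symm.toMonoidHom ⊔ M') := hφ3
        _ ≤ (K 2).map χ.symm.toMonoidHom ⊔ M' := inf_le_right
    · exact central_transport φ hφ0 hM' hM hZN
    · exact central_transport χ.symm (rr_map_symm_of_map χ hχ0) hM' hM hZK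
  -- `ψ := χ ∘ φ`
  have hχM : M.map χ.toMonoidHom = M := rr_map_char χ hM
  have hcomp : ∀ i : Fin 3, (s4Kernels.stabilizeIter m i ⊔ M).map (φ.trans χ).toMonoidHom =
      ((s4Kernels.stabilizeIter m i).map φ.toMonoidHom ⊔ M).map χ.toMonoidHom := fun i => by
    change (s4Kernels.stabilizeIter m i ⊔ M).map (χ.toMonoidHom.comp φ.toMonoidHom) = _
    rw [← Subgroup.map_map, Subgroup.map_sup, hφM]
  have c0 : ((s4Kernels.stabilizeIter m 0).map φ.toMonoidHom ⊔ M).map χ.toMonoidHom = K 0 ⊔ M := by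
    rw [hφ0, Subgroup.map_sup, hχ0, hχM, h0]
  have c1 : ((s4Kernels.stabilizeIter m 1).map φ.toMonoidHom ⊔ M).map χ.toMonoidHom = K 1 ⊔ M := by
    rw [hφ1, Subgroup.map_sup, hχ1, hχM, h1]
  have c2 : ((s4Kernels.stabilizeIter m 2).map φ.toMonoidHom ⊔ M).map χ.toMonoidHom = K 2 ⊔ M := by
    rw [key, Subgroup.map_sup, rr_map_symm_map, hχM]
  refine ⟨φ.trans χ, ?_, ?_, ?_⟩
  · change (s4Kernels.stabilizeIter m 0).map (χ.toMonoidHom.comp φ.toMonoidHom) = _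
    rw [← Subgroup.map_map, hφ0, hχ0]
  · change (s4Kernels.stabilizeIter m 1).map (χ.toMonoidHom.comp φ.toMonoidHom) = _
    rw [← Subgroup.map_map, hφ1, hχ1]
  · exact rr_forall_fin_three (P := fun i => (s4Kernels.stabilizeIter m i ⊔ M).map
        (φ.trans χ).toMonoidHom = K i ⊔ M)
      ((hcomp 0).trans c0) ((hcomp 1).trans c1) ((hcomp 2).trans c2)

/-- **The residue reduction** (registered stub `stub_exactShadowReduction` of line
`finitary-ac-central-residue`).  At genus `3+3m`: effective centrelessness for the standard pair
and for trisection pairs ∧ one-sided normal form (at every characteristic finite-index level) ∧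
intersection rigidity (at every such level) ⟹ for every slot-normalised `(3+3m; m+1)` group
trisection `K` of `{1}` and every characteristic finite-index `M`, some EXACT Goeritz element
`ψ ∈ Stab(N 0) ∩ Stab(N 1)` has `ψ(N i ⊔ M) = K i ⊔ M` for all `i` (the normalised crux with exact
stabilisers).  Effective centrelessness (twice) supplies the deeper level `M' = M₁ ⊓ M₂`;
`exactShadow_step` does the rest. [folklore] -/
theorem stub_exactShadowReduction :
    ∀ (m : ℕ),
      (∀ (M : Subgroup (SurfaceGroup (3 + 3 * m))), M.Characteristic → M.FiniteIndex →
        ∃ M' : Subgroup (SurfaceGroup (3 + 3 * m)), M'.Characteristic ∧ M'.FiniteIndex ∧ M' ≤ M ∧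
          ∀ x ∈ s4Kernels.stabilizeIter m 0, (∀ y ∈ s4Kernels.stabilizeIter m 0,
            y * x * y⁻¹ * x⁻¹ ∈ s4Kernels.stabilizeIter m 2 ⊔ M') →
            x ∈ s4Kernels.stabilizeIter m 2 ⊔ M) →
      (∀ (K : TrisectionKernels (3 + 3 * m)),
        IsGroupTrisection (3 + 3 * m) (m + 1) (PUnit : Type) K →
        K 0 = s4Kernels.stabilizeIter m 0 → K 1 = s4Kernels.stabilizeIter m 1 →
        ∀ M : Subgroup (SurfaceGroup (3 + 3 * m)), M.Characteristic → M.FiniteIndex →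
        ∃ M' : Subgroup (SurfaceGroup (3 + 3 * m)), M'.Characteristic ∧ M'.FiniteIndex ∧ M' ≤ M ∧
          ∀ x ∈ s4Kernels.stabilizeIter m 0, (∀ y ∈ s4Kernels.stabilizeIter m 0,
            y * x * y⁻¹ * x⁻¹ ∈ K 2 ⊔ M') → x ∈ K 2 ⊔ M) →
      (∀ (K : TrisectionKernels (3 + 3 * m)),
        IsGroupTrisection (3 + 3 * m) (m + 1) (PUnit : Type) K →
        K 0 = s4Kernels.stabilizeIter m 0 → K 1 = s4Kernels.stabilizeIter m 1 →
        ∀ M : Subgroup (SurfaceGroup (3 + 3 * m)), M.Characteristic → M.FiniteIndex →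
        ∃ χ : SurfaceGroup (3 + 3 * m) ≃* SurfaceGroup (3 + 3 * m),
          (s4Kernels.stabilizeIter m 0).map χ.toMonoidHom = s4Kernels.stabilizeIter m 0 ∧
          (s4Kernels.stabilizeIter m 1).map χ.toMonoidHom = s4Kernels.stabilizeIter m 1 ∧
          (s4Kernels.stabilizeIter m 2 ⊔ s4Kernels.stabilizeIter m 0 ⊔ M).map χ.toMonoidHom =
            K 2 ⊔ s4Kernels.stabilizeIter m 0 ⊔ M) →
      (∀ (K : TrisectionKernels (3 + 3 * m)),
        IsGroupTrisection (3 + 3 * m) (m + 1) (PUnit : Type) K →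
        K 0 = s4Kernels.stabilizeIter m 0 → K 1 = s4Kernels.stabilizeIter m 1 →
        ∀ M : Subgroup (SurfaceGroup (3 + 3 * m)), M.Characteristic → M.FiniteIndex →
        K 2 ⊔ s4Kernels.stabilizeIter m 0 ⊔ M =
          s4Kernels.stabilizeIter m 2 ⊔ s4Kernels.stabilizeIter m 0 ⊔ M →
        ∃ φ : SurfaceGroup (3 + 3 * m) ≃* SurfaceGroup (3 + 3 * m),
          (s4Kernels.stabilizeIter m 0).map φ.toMonoidHom = s4Kernels.stabilizeIter m 0 ∧
          (s4Kernels.stabilizeIter m 1).map φ.toMonoidHom = s4Kernels.stabilizeIter m 1 ∧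
          (s4Kernels.stabilizeIter m 2 ⊔ s4Kernels.stabilizeIter m 0 ⊔ M).map φ.toMonoidHom =
            s4Kernels.stabilizeIter m 2 ⊔ s4Kernels.stabilizeIter m 0 ⊔ M ∧
          ((s4Kernels.stabilizeIter m 0 ⊔ M) ⊓ (s4Kernels.stabilizeIter m 2 ⊔ M)).map φ.toMonoidHom =
            (s4Kernels.stabilizeIter m 0 ⊔ M) ⊓ (K 2 ⊔ M)) →
      ∀ (K : TrisectionKernels (3 + 3 * m)),
        IsGroupTrisection (3 + 3 * m) (m + 1) (PUnit : Type) K →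
        K 0 = s4Kernels.stabilizeIter m 0 → K 1 = s4Kernels.stabilizeIter m 1 →
        ∀ M : Subgroup (SurfaceGroup (3 + 3 * m)), M.Characteristic → M.FiniteIndex →
        ∃ ψ : SurfaceGroup (3 + 3 * m) ≃* SurfaceGroup (3 + 3 * m),
          (s4Kernels.stabilizeIter m 0).map ψ.toMonoidHom = s4Kernels.stabilizeIter m 0 ∧
          (s4Kernels.stabilizeIter m 1).map ψ.toMonoidHom = s4Kernels.stabilizeIter m 1 ∧
          ∀ i : Fin 3, (s4Kernels.stabilizeIter m i ⊔ M).map ψ.toMonoidHom = K i ⊔ M := by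
  intro m effStd effTri oneSided rigid K hK h0 h1 M hM hMf
  haveI hK2n : (K 2).Normal := hK.normal 2
  obtain ⟨M₁, hM₁c, hM₁f, hM₁le, hZ₁⟩ := effStd M hM hMf
  obtain ⟨M₂, hM₂c, hM₂f, hM₂le, hZ₂⟩ := effTri K hK h0 h1 M hM hMf
  haveI := hM₁f
  haveI := hM₂f
  have hM'c : (M₁ ⊓ M₂).Characteristic := rr_characteristic_inf hM₁c hM₂c
  obtain ⟨χ, hχ0, hχ1, hχ2⟩ := oneSided K hK h0 h1 (M₁ ⊓ M₂) hM'c inferInstance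
  refine exactShadow_step K hK h0 h1 M (M₁ ⊓ M₂) hM hM'c (inf_le_left.trans hM₁le) ?_ ?_ χ hχ0 hχ1
    hχ2 (fun K' hK' h0' h1' hs => rigid K' hK' h0' h1' (M₁ ⊓ M₂) hM'c inferInstance hs)
  · intro x hx h
    have hmono : s4Kernels.stabilizeIter m 2 ⊔ (M₁ ⊓ M₂) ≤ s4Kernels.stabilizeIter m 2 ⊔ M₁ :=
      sup_le_sup_left inf_le_left _
    exact hZ₁ x hx fun y hy => hmono (h y hy)
  · intro x hx h
    have hmono : K 2 ⊔ (M₁ ⊓ M₂) ≤ K 2 ⊔ M₂ := sup_le_sup_left inf_le_right _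
    exact hZ₂ x hx fun y hy => hmono (h y hy)

/-- **Converse: the exact-Goeritz crux implies intersection rigidity** (take `φ := ψ`).
[folklore] -/
theorem rigid_of_exactShadow (m : ℕ)
    (exact : ∀ (K : TrisectionKernels (3 + 3 * m)),
      IsGroupTrisection (3 + 3 * m) (m + 1) (PUnit : Type) K →
      K 0 = s4Kernels.stabilizeIter m 0 → K 1 = s4Kernels.stabilizeIter m 1 →
      ∀ M : Subgroup (SurfaceGroup (3 + 3 * m)), M.Characteristic → M.FiniteIndex →
      ∃ ψ : SurfaceGroup (3 + 3 * m) ≃* SurfaceGroup (3 + 3 * m),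
        (s4Kernels.stabilizeIter m 0).map ψ.toMonoidHom = s4Kernels.stabilizeIter m 0 ∧
        (s4Kernels.stabilizeIter m 1).map ψ.toMonoidHom = s4Kernels.stabilizeIter m 1 ∧
        (s4Kernels.stabilizeIter m 2 ⊔ M).map ψ.toMonoidHom = K 2 ⊔ M) :
    ∀ (K : TrisectionKernels (3 + 3 * m)),
      IsGroupTrisection (3 + 3 * m) (m + 1) (PUnit : Type) K →
      K 0 = s4Kernels.stabilizeIter m 0 → K 1 = s4Kernels.stabilizeIter m 1 →
      ∀ M : Subgroup (SurfaceGroup (3 + 3 * m)), M.Characteristic → M.FiniteIndex →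
      K 2 ⊔ s4Kernels.stabilizeIter m 0 ⊔ M =
        s4Kernels.stabilizeIter m 2 ⊔ s4Kernels.stabilizeIter m 0 ⊔ M →
      ∃ φ : SurfaceGroup (3 + 3 * m) ≃* SurfaceGroup (3 + 3 * m),
        (s4Kernels.stabilizeIter m 0).map φ.toMonoidHom = s4Kernels.stabilizeIter m 0 ∧
        (s4Kernels.stabilizeIter m 1).map φ.toMonoidHom = s4Kernels.stabilizeIter m 1 ∧
        (s4Kernels.stabilizeIter m 2 ⊔ s4Kernels.stabilizeIter m 0 ⊔ M).map φ.toMonoidHom =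
          s4Kernels.stabilizeIter m 2 ⊔ s4Kernels.stabilizeIter m 0 ⊔ M ∧
        ((s4Kernels.stabilizeIter m 0 ⊔ M) ⊓ (s4Kernels.stabilizeIter m 2 ⊔ M)).map φ.toMonoidHom =
          (s4Kernels.stabilizeIter m 0 ⊔ M) ⊓ (K 2 ⊔ M) := by
  intro K hK h0 h1 M hM hMf hsup
  obtain ⟨ψ, hψ0, hψ1, hψ2⟩ := exact K hK h0 h1 M hM hMf
  have hψM : M.map ψ.toMonoidHom = M := rr_map_char ψ hM
  have hψ02 : (s4Kernels.stabilizeIter m 2 ⊔ s4Kernels.stabilizeIter m 0 ⊔ M).map ψ.toMonoidHom =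
      K 2 ⊔ s4Kernels.stabilizeIter m 0 ⊔ M := by
    have e1 : s4Kernels.stabilizeIter m 2 ⊔ s4Kernels.stabilizeIter m 0 ⊔ M =
        (s4Kernels.stabilizeIter m 2 ⊔ M) ⊔ s4Kernels.stabilizeIter m 0 := by
      rw [sup_right_comm]
    have e2 : K 2 ⊔ s4Kernels.stabilizeIter m 0 ⊔ M = (K 2 ⊔ M) ⊔ s4Kernels.stabilizeIter m 0 := by
      rw [sup_right_comm]
    rw [e1, e2, Subgroup.map_sup, hψ2, hψ0]
  refine ⟨ψ, hψ0, hψ1, by rw [hψ02, hsup], ?_⟩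
  rw [Subgroup.map_inf_eq _ _ _ ψ.injective, Subgroup.map_sup, hψ0, hψM, hψ2]

/-! ## Genus 3: intersection rigidity ⟺ the normalised crux with exact Goeritz stabilisers -/

/-- **Genus 3, forward.** Intersection rigidity at genus `3` (all levels) gives, for every
Waldhausen-normalised `(3;1)` group trisection of `{1}` and every characteristic finite-index
level, an EXACT Goeritz element standardising all three shadows — the one-sided normal form being
the tree's face normal form `stub_faceNormalFormGenusThree`. [folklore] -/
theorem exactShadow_genusThree_of_rigid
    (rigid : ∀ (K : TrisectionKernels 3), IsGroupTrisection 3 1 (PUnit : Type) K →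
      K 0 = s4Kernels 0 → K 1 = s4Kernels 1 →
      ∀ M : Subgroup (SurfaceGroup 3), M.Characteristic → M.FiniteIndex →
      K 2 ⊔ s4Kernels 0 ⊔ M = s4Kernels 2 ⊔ s4Kernels 0 ⊔ M →
      ∃ φ : SurfaceGroup 3 ≃* SurfaceGroup 3,
        (s4Kernels 0).map φ.toMonoidHom = s4Kernels 0 ∧ (s4Kernels 1).map φ.toMonoidHom = s4Kernels 1 ∧
        (s4Kernels 2 ⊔ s4Kernels 0 ⊔ M).map φ.toMonoidHom = s4Kernels 2 ⊔ s4Kernels 0 ⊔ M ∧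
        ((s4Kernels 0 ⊔ M) ⊓ (s4Kernels 2 ⊔ M)).map φ.toMonoidHom = (s4Kernels 0 ⊔ M) ⊓ (K 2 ⊔ M)) :
    ∀ (K : TrisectionKernels 3), IsGroupTrisection 3 1 (PUnit : Type) K →
      K 0 = s4Kernels 0 → K 1 = s4Kernels 1 →
      ∀ M : Subgroup (SurfaceGroup 3), M.Characteristic → M.FiniteIndex →
      ∃ ψ : SurfaceGroup 3 ≃* SurfaceGroup 3,
        (s4Kernels 0).map ψ.toMonoidHom = s4Kernels 0 ∧ (s4Kernels 1).map ψ.toMonoidHom = s4Kernels 1 ∧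
        ∀ i : Fin 3, (s4Kernels i ⊔ M).map ψ.toMonoidHom = K i ⊔ M := by
  refine stub_exactShadowReduction 0 (stub_effectiveCentrelessStd 0)
    (stub_effectiveCentrelessTrisection 0) (fun K hK h0 h1 M hM _ => ?_) rigid
  obtain ⟨χ, hχ0, hχ1, hχ2⟩ := stub_faceNormalFormGenusThree K hK h0 h1
  refine ⟨χ, hχ0, hχ1, ?_⟩
  change (s4Kernels 2 ⊔ s4Kernels 0 ⊔ M).map χ.toMonoidHom = K 2 ⊔ s4Kernels 0 ⊔ M
  rw [Subgroup.map_sup, hχ2, rr_map_char χ hM]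

/-- **Genus 3: intersection rigidity is EQUIVALENT to the normalised crux with exact Goeritz
stabilisers** (the honest size of the line's residual at the first open genus). [folklore] -/
theorem rigid_genusThree_iff_exactShadow :
    (∀ (K : TrisectionKernels 3), IsGroupTrisection 3 1 (PUnit : Type) K →
      K 0 = s4Kernels 0 → K 1 = s4Kernels 1 →
      ∀ M : Subgroup (SurfaceGroup 3), M.Characteristic → M.FiniteIndex →
      K 2 ⊔ s4Kernels 0 ⊔ M = s4Kernels 2 ⊔ s4Kernels 0 ⊔ M →
      ∃ φ : SurfaceGroup 3 ≃* SurfaceGroup 3,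
        (s4Kernels 0).map φ.toMonoidHom = s4Kernels 0 ∧ (s4Kernels 1).map φ.toMonoidHom = s4Kernels 1 ∧
        (s4Kernels 2 ⊔ s4Kernels 0 ⊔ M).map φ.toMonoidHom = s4Kernels 2 ⊔ s4Kernels 0 ⊔ M ∧
        ((s4Kernels 0 ⊔ M) ⊓ (s4Kernels 2 ⊔ M)).map φ.toMonoidHom = (s4Kernels 0 ⊔ M) ⊓ (K 2 ⊔ M)) ↔
    (∀ (K : TrisectionKernels 3), IsGroupTrisection 3 1 (PUnit : Type) K →
      K 0 = s4Kernels 0 → K 1 = s4Kernels 1 →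
      ∀ M : Subgroup (SurfaceGroup 3), M.Characteristic → M.FiniteIndex →
      ∃ ψ : SurfaceGroup 3 ≃* SurfaceGroup 3,
        (s4Kernels 0).map ψ.toMonoidHom = s4Kernels 0 ∧ (s4Kernels 1).map ψ.toMonoidHom = s4Kernels 1 ∧
        (s4Kernels 2 ⊔ M).map ψ.toMonoidHom = K 2 ⊔ M) := by
  constructor
  · intro rigid K hK h0 h1 M hM hMf
    obtain ⟨ψ, hψ0, hψ1, hψ⟩ := exactShadow_genusThree_of_rigid rigid K hK h0 h1 M hM hMf
    exact ⟨ψ, hψ0, hψ1, hψ 2⟩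
  · intro exact
    exact rigid_of_exactShadow 0 exact

/-- **Genus 3: intersection rigidity + the `(0,1)` slice of `WaldhausenPairs` ⟹ the genus-3 case
of the crux `ShadowsStandard`** (`ShadowStandardAt 0 K M` for every `(3;1)` group trisection `K` of
`{1}` and every characteristic finite-index `M`). [folklore] -/
theorem shadowStandardAt_genusThree_of_rigid
    (rigid : ∀ (K : TrisectionKernels 3), IsGroupTrisection 3 1 (PUnit : Type) K →
      K 0 = s4Kernels 0 → K 1 = s4Kernels 1 →
      ∀ M : Subgroup (SurfaceGroup 3), M.Characteristic → M.FiniteIndex →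
      K 2 ⊔ s4Kernels 0 ⊔ M = s4Kernels 2 ⊔ s4Kernels 0 ⊔ M →
      ∃ φ : SurfaceGroup 3 ≃* SurfaceGroup 3,
        (s4Kernels 0).map φ.toMonoidHom = s4Kernels 0 ∧ (s4Kernels 1).map φ.toMonoidHom = s4Kernels 1 ∧
        (s4Kernels 2 ⊔ s4Kernels 0 ⊔ M).map φ.toMonoidHom = s4Kernels 2 ⊔ s4Kernels 0 ⊔ M ∧
        ((s4Kernels 0 ⊔ M) ⊓ (s4Kernels 2 ⊔ M)).map φ.toMonoidHom = (s4Kernels 0 ⊔ M) ⊓ (K 2 ⊔ M))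
    (pairs : ∀ (K : TrisectionKernels 3), IsGroupTrisection 3 1 (PUnit : Type) K →
      ∃ α : SurfaceGroup 3 ≃* SurfaceGroup 3,
        (s4Kernels 0).map α.toMonoidHom = K 0 ∧ (s4Kernels 1).map α.toMonoidHom = K 1) :
    ∀ (K : TrisectionKernels 3), IsGroupTrisection 3 1 (PUnit : Type) K →
      ∀ M : Subgroup (SurfaceGroup 3), M.Characteristic → M.FiniteIndex → ShadowStandardAt 0 K M := by
  intro K hK M hM hMf
  obtain ⟨α, hα0, hα1⟩ := pairs K hK
  have hK' : IsGroupTrisection 3 1 (PUnit : Type) (fun i => (K i).map α.symm.toMonoidHom) :=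
    isGroupTrisection_map_equiv hK α.symm
  obtain ⟨ψ, -, -, hψ⟩ := exactShadow_genusThree_of_rigid rigid (fun i => (K i).map α.symm.toMonoidHom)
    hK' (rr_map_symm_of_map α hα0) (rr_map_symm_of_map α hα1) M hM hMf
  have hψ' : ∀ i : Fin 3,
      (s4Kernels i ⊔ M).map ψ.toMonoidHom = (K i).map α.symm.toMonoidHom ⊔ M := hψ
  refine ⟨ψ.trans α, fun i => ?_⟩
  change (s4Kernels i ⊔ M).map (α.toMonoidHom.comp ψ.toMonoidHom) = K i ⊔ M
  rw [← Subgroup.map_map, hψ' i, Subgroup.map_sup, rr_map_symm_map, rr_map_char α hM]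

end Summit.SmoothPoincare4.SmoothPoincare4.Theorems.ShadowsStandard.FinitaryAcCentralResidue

end
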